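import Literature.NumberTheory.Transcendental.RoySmallValueFactors
import Mathlib.Algebra.MvPolynomial.NoZeroDivisors
import Mathlib.RingTheory.Polynomial.UniqueFactorization
import HarnessLib

/-!
# Roy's small value estimate for `𝔾ₐ × 𝔾ₘ` — a combination of the derivatives coprime to `P`

Topic `Literature/NumberTheory/Transcendental`. Part of the formalisation of the proof of Roy 2013,
Theorem 1.1 (named fact `roy2013_thm_1_1`, `RoySmallValueEstimates.lean`), seat B. Source: D. Roy,
*A small value estimate for `𝔾ₐ × 𝔾ₘ`*, Mathematika 59 (2013) 333–363 = arXiv:1301.0663, §6,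
proof of Proposition 6.4 (p. 17 of the arXiv text): "By Lemma 5.4, the polynomials
`P, 𝒟P, …, 𝒟^D P` are relatively prime as a set. Since they are all homogeneous of degree `D`, we
conclude that there exist integers `a₁, …, a_D` of absolute values at most `D` such that
`Q = ∑_{i=1}^D aᵢ 𝒟ⁱP` is relatively prime to `P`."

We prove this with the explicit choice `aᵢ = tⁱ` for a natural number `t ≤ D²`
(`exists_coprime_deriv_combination`): for each prime factor `q` of `P` (there are at most `D`
of them, `card_factors_le`), the residues of `∑ᵢ tⁱ 𝒟ⁱP` modulo `q`, as `t` varies, are the values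
at `t` of a non-zero polynomial of degree `≤ D` over the domain `ℂ[X]/(q)` (non-zero by
Lemma 5.4, `lemma_5_4_no_common_factor`), which has at most `D` roots. (Any bound `tⁱ ≤ D^{2D}`
on the coefficients is harmless in §7, where only `log ‖Q‖ = o(D^β)` matters.)

Everything is proved; no definitions, no named facts.

## References

* [Roy2013] D. Roy, *A small value estimate for 𝔾ₐ × 𝔾ₘ*, Mathematika 59 (2013), 333–363
  (arXiv:1301.0663), §6, proof of Prop. 6.4 (the polynomial `Q`).
-/

noncomputable section

open MvPolynomial Finset UniqueFactorizationMonoid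

namespace Literature.NumberTheory.Transcendental

namespace Roy2013

/-! ### Prime factors of a form -/

/-- A non-zero non-unit polynomial over a field has positive total degree. [folklore] -/
theorem totalDegree_pos_of_not_isUnit {σ : Type*} {q : MvPolynomial σ ℂ} (hq0 : q ≠ 0)
    (hqu : ¬IsUnit q) : 0 < q.totalDegree := by
  rw [Nat.pos_iff_ne_zero]
  intro h0
  rw [totalDegree_eq_zero_iff_eq_C] at h0
  apply hqu
  have hc : q.coeff 0 ≠ 0 := fun hc => hq0 (by rw [h0, hc, C_0])
  rw [h0]
  exact (isUnit_iff_ne_zero.mpr hc).map C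

/-- The total degree of a product of non-zero polynomials (over a domain) is the sum of the total
degrees. [folklore] -/
theorem totalDegree_multiset_prod {σ : Type*} (s : Multiset (MvPolynomial σ ℂ)) (hs : ∀ q ∈ s, q ≠ 0) :
    s.prod.totalDegree = (s.map totalDegree).sum := by
  induction s using Multiset.induction with
  | empty => simp
  | cons a s ih =>
    have ha : a ≠ 0 := hs a (Multiset.mem_cons_self _ _)
    have hs' : ∀ q ∈ s, q ≠ 0 := fun q hq => hs q (Multiset.mem_cons_of_mem hq)
    have hprod : s.prod ≠ 0 := Multiset.prod_ne_zero fun h => hs' 0 h rfl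
    rw [Multiset.prod_cons, Multiset.map_cons, Multiset.sum_cons,
      totalDegree_mul_of_isDomain ha hprod, ih hs']

/-- **A form of degree `D` has at most `D` prime factors** (counted with multiplicity).
[folklore] -/
theorem card_factors_le {P : CX} {D : ℕ} (hP : P.IsHomogeneous D) (hP0 : P ≠ 0) :
    Multiset.card (factors P) ≤ D := by
  classical
  have hne : ∀ q ∈ factors P, q ≠ 0 := fun q hq => (prime_of_factor q hq).ne_zero
  have hdeg : ∀ q ∈ factors P, 1 ≤ q.totalDegree := fun q hq =>
    totalDegree_pos_of_not_isUnit (hne q hq) (prime_of_factor q hq).not_unit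
  obtain ⟨u, hu⟩ := factors_prod hP0
  have hprod0 : (factors P).prod ≠ 0 := Multiset.prod_ne_zero fun h => hne 0 h rfl
  have hD : (factors P).prod.totalDegree = D := by
    obtain ⟨c, -, hcu⟩ := isUnit_iff_eq_C_of_isReduced.mp u.isUnit
    have h1 : P.totalDegree = D := hP.totalDegree hP0
    have hc0 : (C c : CX) ≠ 0 := by rw [← hcu]; exact u.ne_zero
    have h2 : ((factors P).prod * ↑u).totalDegree = D := by rw [hu]; exact h1
    rwa [hcu, totalDegree_mul_of_isDomain hprod0 hc0, totalDegree_C, add_zero] at h2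
  rw [totalDegree_multiset_prod _ hne] at hD
  calc Multiset.card (factors P) = (Multiset.map (fun _ => 1) (factors P)).sum := by
        rw [Multiset.map_const', Multiset.sum_replicate, smul_eq_mul, mul_one]
    _ ≤ (Multiset.map totalDegree (factors P)).sum :=
        Multiset.sum_map_le_sum_map _ _ fun q hq => hdeg q hq
    _ = D := hD

/-! ### The combination `∑ tⁱ 𝒟ⁱP` -/

/-- Residues: `∑ᵢ tⁱ 𝒟ⁱP mod q` is the value at `t` of the polynomial `∑ᵢ (𝒟ⁱP mod q) Xⁱ`.
[cite: Roy2013, §6, proof of Prop. 6.4] -/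
theorem mk_sum_pow_smul_eq_eval (q P : CX) (D t : ℕ) :
    Ideal.Quotient.mk (Ideal.span {q}) (∑ i ∈ Icc 1 D, ((t : ℂ) ^ i) • homD^[i] P) =
      (∑ i ∈ Icc 1 D, Polynomial.C (Ideal.Quotient.mk (Ideal.span {q}) (homD^[i] P)) *
        Polynomial.X ^ i).eval (t : CX ⧸ Ideal.span {q}) := by
  rw [map_sum, Polynomial.eval_finsetSum]
  refine Finset.sum_congr rfl fun i _ => ?_
  rw [Polynomial.eval_mul, Polynomial.eval_C, Polynomial.eval_pow, Polynomial.eval_X, smul_eq_C_mul,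
    map_mul, mul_comm]
  congr 1
  rw [C_pow, map_pow, map_natCast, map_natCast]

/-- **A combination `Q = ∑_{i=1}^D tⁱ 𝒟ⁱP` coprime to `P`**, for a form `P ∈ ℂ[X]_D` not divisible
by `X₀` nor by `X₂`, with `t ≤ D²`. [cite: Roy2013, §6, proof of Prop. 6.4 (the polynomial `Q`)] -/
theorem exists_coprime_deriv_combination {P : CX} {D : ℕ} (hP : P.IsHomogeneous D) (hP0 : P ≠ 0)
    (hX0 : ¬ X 0 ∣ P) (hX2 : ¬ X 2 ∣ P) :
    ∃ t : ℕ, t ≤ D ^ 2 ∧ IsRelPrime P (∑ i ∈ Icc 1 D, ((t : ℂ) ^ i) • homD^[i] P) := by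
  classical
  set fs := factors P with hfs
  -- bad values of `t` for a prime factor `q`
  let bad : CX → Finset ℕ := fun q =>
    (Finset.range (D ^ 2 + 1)).filter fun t => q ∣ ∑ i ∈ Icc 1 D, ((t : ℂ) ^ i) • homD^[i] P
  have hbad : ∀ q ∈ fs, (bad q).card ≤ D := by
    intro q hq
    have hqp : Prime q := prime_of_factor q hq
    haveI : (Ideal.span {q} : Ideal CX).IsPrime := (Ideal.span_singleton_prime hqp.ne_zero).mpr hqp
    set A := CX ⧸ Ideal.span {q} with hA
    haveI : IsDomain A := Ideal.Quotient.isDomain _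
    haveI : CharZero A := charZero_of_injective_algebraMap (algebraMap ℂ A).injective
    set mk : CX →+* A := Ideal.Quotient.mk (Ideal.span {q}) with hmk
    set f : Polynomial A := ∑ i ∈ Icc 1 D, Polynomial.C (mk (homD^[i] P)) * Polynomial.X ^ i with hf
    -- `f ≠ 0` by Lemma 5.4
    have hcoeff : ∀ i ∈ Icc 1 D, f.coeff i = mk (homD^[i] P) := by
      intro i hi
      rw [hf, Polynomial.finsetSum_coeff]
      simp_rw [Polynomial.coeff_C_mul_X_pow]
      rw [Finset.sum_eq_single i (fun j _ hj => if_neg (Ne.symm hj)) (fun h => absurd hi h),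
        if_pos rfl]
    have hf0 : f ≠ 0 := by
      intro h0
      apply lemma_5_4_no_common_factor (K := ℂ) hP hP0 hX0 hX2 hqp.irreducible (R := q)
      intro i hi
      rcases Nat.eq_zero_or_pos i with rfl | hipos
      · exact dvd_of_mem_factors hq
      · have hi' : i ∈ Icc 1 D := mem_Icc.mpr ⟨hipos, hi⟩
        have := hcoeff i hi'
        rw [h0, Polynomial.coeff_zero] at this
        have hmem : homD^[i] P ∈ Ideal.span {q} := Ideal.Quotient.eq_zero_iff_mem.mp this.symm
        exact Ideal.mem_span_singleton.mp hmem
    have hdeg : f.natDegree ≤ D := by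
      rw [hf]
      refine Polynomial.natDegree_sum_le_of_forall_le _ _ fun i hi => ?_
      exact (Polynomial.natDegree_C_mul_X_pow_le _ _).trans (mem_Icc.mp hi).2
    -- bad `t` are roots of `f`
    have hroots : ∀ t ∈ bad q, (t : A) ∈ f.roots := by
      intro t ht
      rw [Polynomial.mem_roots hf0, Polynomial.IsRoot.def, hf, ← mk_sum_pow_smul_eq_eval]
      have := (Finset.mem_filter.mp ht).2
      exact Ideal.Quotient.eq_zero_iff_mem.mpr (Ideal.mem_span_singleton.mpr this)
    calc (bad q).card = ((bad q).image (fun t : ℕ => (t : A))).card :=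
          (Finset.card_image_of_injective _ Nat.cast_injective).symm
      _ ≤ f.roots.toFinset.card := Finset.card_le_card fun x hx => by
          obtain ⟨t, ht, rfl⟩ := Finset.mem_image.mp hx
          exact Multiset.mem_toFinset.mpr (hroots t ht)
      _ ≤ Multiset.card f.roots := Multiset.toFinset_card_le _
      _ ≤ f.natDegree := Polynomial.card_roots' f
      _ ≤ D := hdeg
  -- a good `t ≤ D²`
  have hcard : (fs.toFinset.biUnion bad).card < (Finset.range (D ^ 2 + 1)).card := by
    calc (fs.toFinset.biUnion bad).card ≤ ∑ q ∈ fs.toFinset, (bad q).card := Finset.card_biUnion_le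
      _ ≤ ∑ _q ∈ fs.toFinset, D := Finset.sum_le_sum fun q hq => hbad q (Multiset.mem_toFinset.mp hq)
      _ = fs.toFinset.card * D := by rw [Finset.sum_const, smul_eq_mul]
      _ ≤ Multiset.card fs * D := Nat.mul_le_mul_right _ (Multiset.toFinset_card_le _)
      _ ≤ D * D := Nat.mul_le_mul_right _ (card_factors_le hP hP0)
      _ < D ^ 2 + 1 := by rw [sq]; exact Nat.lt_succ_self _
      _ = _ := (Finset.card_range _).symm
  obtain ⟨t, ht, htbad⟩ := Finset.exists_mem_notMem_of_card_lt_card hcard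
  refine ⟨t, by have := Finset.mem_range.mp ht; omega, ?_⟩
  -- coprimality: a common non-unit divisor would have a prime factor among the `factors P`
  intro d hdP hdQ
  by_contra hdu
  have hd0 : d ≠ 0 := by rintro rfl; exact hP0 (zero_dvd_iff.mp hdP)
  obtain ⟨p, hp, hpd⟩ := WfDvdMonoid.exists_irreducible_factor hdu hd0
  obtain ⟨q, hq, hpq⟩ := exists_mem_factors_of_dvd hP0 hp (hpd.trans hdP)
  apply htbad
  refine Finset.mem_biUnion.mpr ⟨q, Multiset.mem_toFinset.mpr hq, Finset.mem_filter.mpr ⟨ht, ?_⟩⟩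
  exact hpq.symm.dvd.trans (hpd.trans hdQ)

end Roy2013

end Literature.NumberTheory.Transcendental
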